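import Literature.NumberTheory.LFunctions.GRHTwistedCharacterPrimeSumsRemainder
import Literature.NumberTheory.LFunctions.ExplicitFormulaPsiCharProofs
import Mathlib.NumberTheory.AbelSummation
import HarnessLib

/-!
# Twisted prime sums under GRH, III: Abel summation of the explicit formula

Topic `Literature/NumberTheory/LFunctions`. THEOREMS (everything proved). Third support file of
the GRH bound for the twisted Chebyshev function `ψ(x, χ, t) = ∑_{n ≤ x} χ(n) Λ(n) n^{-it}`
(`GRHTwistedCharacterPrimeSums.lean`). For a primitive `χ` mod `q > 1`, `T ≥ 2`, a real `t`,
`c ∈ [9/4, 11/4]` and `X ≥ 3` we prove the pointwise inequality (`norm_twistedSum_add_zeroSums_le`)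

  `‖∑_{2 < n ≤ X} χ(n)Λ(n) n^{-it} + ∑_{ρ, |γ| ≤ T} m(ρ) (X^{ρ-it} − c^{ρ-it})/(ρ − it)‖`
  `  ≤ (2K + 3) log X + 2K (X/T) log²(qXT) + |t| K (4X log X/(cT)^{1/2} + X log²(qXT)/T)`,

`K` being the constant of the truncated explicit formula for `ψ₀(u, χ)` (Montgomery–Vaughan
Thm. 12.10, PROVED in the tree: `truncatedExplicitFormula_psiChar_holds`) on `u ≥ 2`. Proof: Abel
summation (Mathlib `sum_mul_eq_sub_sub_integral_mul`) with `f(u) = u^{-it}`; write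
`ψ = E + (ψ − E)`, `E(u) = −∑ m(ρ) u^ρ/ρ − ½ log(u − 1) − (χ(−1)/2) log(u + 1) + C(χ)` the main term
of the explicit formula; integrate the smooth part by parts (`∫ E f' = [E f] − ∫ E' f`: the
constant `C(χ)` disappears and `∫_c^X u^{ρ-1-it} du = (X^{ρ-it} − c^{ρ-it})/(ρ − it)` is the
twisted zero sum); the log part is `≤ (3/2) log X`; the remainder `it ∫ (ψ − E) u^{-it-1}`
(`ψ = ψ₀` off the integers, `‖ψ₀ − E‖ ≤ K R⋆` by Thm. 12.10) is bounded by
`GRHTwistedPrimeSum.norm_integral_remainder_le`. No Riemann hypothesis is used in this file.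

## References

* H. L. Montgomery, R. C. Vaughan, *Multiplicative Number Theory I. Classical Theory*, CUP 2007,
  Theorem 12.10, proof of Theorem 13.7. [MontgomeryVaughan2007]
-/

noncomputable section

open Complex Filter Topology Set MeasureTheory intervalIntegral
open scoped Real ArithmeticFunction.vonMangoldt

namespace Literature.NumberTheory.LFunctions

namespace GRHTwistedPrimeSum

open DirichletCharacter ExplicitPsiChar
open Literature.NumberTheory.Sieve (chebyshevPsiChar)

/-! ### The twist `u ↦ u^{-it}` -/

/-- `d/du u^{-it} = (−it) u^{-it-1}` for `u > 0` (also for `t = 0`). [folklore] -/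
theorem hasDerivAt_cpow_twist (t : ℝ) {u : ℝ} (hu : 0 < u) :
    HasDerivAt (fun y : ℝ ↦ (y : ℂ) ^ (-(t * I))) ((-(t * I)) * (u : ℂ) ^ (-(t * I) - 1)) u := by
  rcases eq_or_ne t 0 with rfl | ht
  · simp only [ofReal_zero, zero_mul, neg_zero, cpow_zero]
    exact hasDerivAt_const _ _
  · have h : (-(t * I) : ℂ) ≠ 0 := by simp [ht, I_ne_zero]
    exact hasDerivAt_ofReal_cpow_const hu.ne' h

/-- `‖(−it) u^{-it-1}‖ = |t|/u` for `u > 0`. [folklore] -/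
theorem norm_deriv_twist {u : ℝ} (hu : 0 < u) (t : ℝ) :
    ‖(-(t * I)) * (u : ℂ) ^ (-(t * I) - 1)‖ = |t| * u⁻¹ := by
  rw [norm_mul, norm_neg, norm_mul, norm_real, norm_I, mul_one, Real.norm_eq_abs,
    norm_cpow_eq_rpow_re_of_pos hu]
  simp [Real.rpow_neg_one]

/-- `‖u^{-it}‖ = 1` for `u > 0`. [folklore] -/
theorem norm_cpow_twist {u : ℝ} (hu : 0 < u) (t : ℝ) : ‖(u : ℂ) ^ (-(t * I))‖ = 1 := by
  rw [norm_cpow_eq_rpow_re_of_pos hu]; simp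

/-- `u ↦ u^s` is continuous on `[a, b]`, `a > 0`. [folklore] -/
theorem continuousOn_ofReal_cpow (s : ℂ) {a b : ℝ} (ha : 0 < a) :
    ContinuousOn (fun y : ℝ ↦ (y : ℂ) ^ s) (Icc a b) := fun y hy ↦
  (continuousAt_ofReal_cpow_const y s (Or.inr (ha.trans_le hy.1).ne')).continuousWithinAt

/-! ### The main term of the explicit formula and its derivative -/

/-- The derivative of `E(u) = −∑ m(ρ) u^ρ/ρ − ½ log(u − 1) − (e/2) log(u + 1) + C` at `u > 1`
(the `ρ` being non-zero): `E'(u) = −∑ m(ρ) u^{ρ-1} − ½ (u − 1)⁻¹ − (e/2)(u + 1)⁻¹`. [folklore] -/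
theorem hasDerivAt_mainTerm (P : Finset ℂ) (m : ℂ → ℂ) (hP : ∀ ρ ∈ P, ρ ≠ 0) (e C : ℂ) {u : ℝ}
    (hu : 1 < u) :
    HasDerivAt (fun y : ℝ ↦ -(∑ ρ ∈ P, m ρ * ((y : ℂ) ^ ρ / ρ)) - 1 / 2 * (Real.log (y - 1) : ℂ) -
        e / 2 * (Real.log (y + 1) : ℂ) + C)
      (-(∑ ρ ∈ P, m ρ * (u : ℂ) ^ (ρ - 1)) - 1 / 2 * (((u - 1)⁻¹ : ℝ) : ℂ) -
        e / 2 * (((u + 1)⁻¹ : ℝ) : ℂ)) u := by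
  have hu0 : u ≠ 0 := by positivity
  have hZ : HasDerivAt (fun y : ℝ ↦ ∑ ρ ∈ P, m ρ * ((y : ℂ) ^ ρ / ρ))
      (∑ ρ ∈ P, m ρ * (u : ℂ) ^ (ρ - 1)) u := by
    refine HasDerivAt.fun_sum fun ρ hρ ↦ ?_
    have h1 : ρ - 1 ≠ -1 := fun h ↦ hP ρ hρ (by linear_combination h)
    have h := hasDerivAt_ofReal_cpow_const' (r := ρ - 1) hu0 h1
    simp only [sub_add_cancel] at h
    exact h.const_mul (m ρ)
  have hl1 : HasDerivAt (fun y : ℝ ↦ ((Real.log (y - 1) : ℝ) : ℂ)) (((u - 1)⁻¹ : ℝ) : ℂ) u := by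
    have h := (((hasDerivAt_id' u).sub_const 1).log (by linarith)).ofReal_comp
    simpa [one_div] using h
  have hl2 : HasDerivAt (fun y : ℝ ↦ ((Real.log (y + 1) : ℝ) : ℂ)) (((u + 1)⁻¹ : ℝ) : ℂ) u := by
    have h := (((hasDerivAt_id' u).add_const 1).log (by linarith)).ofReal_comp
    simpa [one_div] using h
  have h := ((hZ.neg.sub (hl1.const_mul (1 / 2 : ℂ))).sub (hl2.const_mul (e / 2))).add_const C
  simpa using h

/-- The zero part of `∫_c^X E'(u) u^{-it} du`:
`∫_c^X (∑ m(ρ) u^{ρ-1}) u^{-it} du = ∑ m(ρ) (X^{ρ-it} − c^{ρ-it})/(ρ − it)` (`0 < c ≤ X`,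
`Re ρ > 0`). [folklore] -/
theorem integral_zeroDeriv_mul_twist (P : Finset ℂ) (m : ℂ → ℂ) (hP : ∀ ρ ∈ P, 0 < ρ.re) (t : ℝ)
    {c X : ℝ} (hc : 0 < c) (hcX : c ≤ X) :
    ∫ u in c..X, (∑ ρ ∈ P, m ρ * (u : ℂ) ^ (ρ - 1)) * (u : ℂ) ^ (-(t * I)) =
      ∑ ρ ∈ P, m ρ * (((X : ℂ) ^ (ρ - t * I) - (c : ℂ) ^ (ρ - t * I)) / (ρ - t * I)) := by
  have heq : EqOn (fun u : ℝ ↦ (∑ ρ ∈ P, m ρ * (u : ℂ) ^ (ρ - 1)) * (u : ℂ) ^ (-(t * I)))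
      (fun u ↦ ∑ ρ ∈ P, m ρ * (u : ℂ) ^ (ρ - t * I - 1)) (uIcc c X) := by
    intro u hu
    rw [uIcc_of_le hcX] at hu
    have hu0 : (u : ℂ) ≠ 0 := ofReal_ne_zero.2 (hc.trans_le hu.1).ne'
    dsimp only
    rw [Finset.sum_mul]
    refine Finset.sum_congr rfl fun ρ _ ↦ ?_
    rw [mul_assoc, ← cpow_add _ _ hu0]
    ring_nf
  have hint : ∀ ρ ∈ P, IntervalIntegrable (fun u : ℝ ↦ m ρ * (u : ℂ) ^ (ρ - t * I - 1)) volume c X :=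
    fun ρ _ ↦ ((continuousOn_ofReal_cpow _ hc).intervalIntegrable_of_Icc hcX).const_mul _
  rw [intervalIntegral.integral_congr heq, intervalIntegral.integral_finsetSum hint]
  refine Finset.sum_congr rfl fun ρ hρ ↦ ?_
  rw [intervalIntegral.integral_const_mul, integral_cpow]
  · simp only [sub_add_cancel]
  · right
    refine ⟨fun h ↦ ?_, ?_⟩
    · have := congrArg Complex.re h
      simp at this; linarith [hP ρ hρ]
    · rw [uIcc_of_le hcX]
      exact fun h ↦ lt_irrefl (0 : ℝ) (hc.trans_le h.1)

/-- The logarithmic part of `∫_c^X E'(u) u^{-it} du` is `O(log X)`: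
`‖∫_c^X (−½(u−1)⁻¹ − (e/2)(u+1)⁻¹) u^{-it} du‖ ≤ (3/2) log X` for `2 ≤ c ≤ X`, `|e| ≤ 1`
(`(u − 1)⁻¹ ≤ 2/u`, `∫_c^X du/u = log(X/c) ≤ log X`). [folklore] -/
theorem norm_integral_logDeriv_mul_twist_le {e : ℂ} (he : ‖e‖ ≤ 1) (t : ℝ) {c X : ℝ} (hc : 2 ≤ c)
    (hcX : c ≤ X) :
    ‖∫ u in c..X, (-(1 / 2 * (((u - 1)⁻¹ : ℝ) : ℂ)) - e / 2 * (((u + 1)⁻¹ : ℝ) : ℂ)) *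
        (u : ℂ) ^ (-(t * I))‖ ≤ 3 / 2 * Real.log X := by
  have hc0 : 0 < c := by linarith
  have hX0 : 0 < X := by linarith
  have hbound : ∀ᵐ u : ℝ, u ∈ Ioc c X →
      ‖(-(1 / 2 * (((u - 1)⁻¹ : ℝ) : ℂ)) - e / 2 * (((u + 1)⁻¹ : ℝ) : ℂ)) * (u : ℂ) ^ (-(t * I))‖ ≤
        3 / 2 * u⁻¹ := by
    refine ae_of_all _ fun u hu ↦ ?_
    have hu2 : 2 < u := lt_of_le_of_lt hc hu.1
    have hu0 : 0 < u := by linarith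
    rw [norm_mul, norm_cpow_twist hu0, mul_one]
    have h1 : ‖(1 / 2 : ℂ) * (((u - 1)⁻¹ : ℝ) : ℂ)‖ = 1 / 2 * (u - 1)⁻¹ := by
      rw [norm_mul, norm_real, Real.norm_of_nonneg (inv_nonneg.2 (by linarith))]
      norm_num
    have h2 : ‖e / 2 * (((u + 1)⁻¹ : ℝ) : ℂ)‖ ≤ 1 / 2 * (u + 1)⁻¹ := by
      rw [norm_mul, norm_div, norm_real, Real.norm_of_nonneg (inv_nonneg.2 (by linarith)),
        Complex.norm_two]
      exact mul_le_mul_of_nonneg_right (by linarith) (inv_nonneg.2 (by linarith))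
    have h3 : (u - 1)⁻¹ ≤ 2 * u⁻¹ := by
      rw [inv_le_comm₀ (by linarith) (by positivity), mul_inv, inv_inv]; linarith
    have h4 : (u + 1)⁻¹ ≤ u⁻¹ := inv_anti₀ hu0 (by linarith)
    calc ‖-((1 / 2 : ℂ) * (((u - 1)⁻¹ : ℝ) : ℂ)) - e / 2 * (((u + 1)⁻¹ : ℝ) : ℂ)‖
        ≤ ‖(1 / 2 : ℂ) * (((u - 1)⁻¹ : ℝ) : ℂ)‖ + ‖e / 2 * (((u + 1)⁻¹ : ℝ) : ℂ)‖ := by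
          rw [sub_eq_add_neg, ← neg_add, norm_neg]
          exact norm_add_le _ _
      _ ≤ 1 / 2 * (u - 1)⁻¹ + 1 / 2 * (u + 1)⁻¹ := by rw [h1]; linarith
      _ ≤ 3 / 2 * u⁻¹ := by linarith
  have hint : IntervalIntegrable (fun u : ℝ ↦ 3 / 2 * u⁻¹) volume c X := by
    refine (intervalIntegral.intervalIntegrable_inv (fun u hu ↦ ?_) continuousOn_id).const_mul _
    rw [uIcc_of_le hcX] at hu
    exact (hc0.trans_le hu.1).ne'
  calc _ ≤ ∫ u in c..X, 3 / 2 * u⁻¹ := intervalIntegral.norm_integral_le_of_norm_le hcX hbound hint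
    _ = 3 / 2 * Real.log (X / c) := by
        rw [intervalIntegral.integral_const_mul, integral_inv_of_pos hc0 hX0]
    _ ≤ 3 / 2 * Real.log X := by
        rw [Real.log_div hX0.ne' hc0.ne']
        linarith [Real.log_nonneg (by linarith : (1 : ℝ) ≤ c)]

/-- Almost every real number is not a natural number. [folklore] -/
theorem ae_natFloor_ne : ∀ᵐ u : ℝ, ((⌊u⌋₊ : ℕ) : ℝ) ≠ u := by
  have h0 : volume (Set.range (Nat.cast : ℕ → ℝ)) = 0 := (Set.countable_range _).measure_zero volume
  filter_upwards [measure_eq_zero_iff_ae_notMem.1 h0] with u hu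
  exact fun h ↦ hu ⟨⌊u⌋₊, h⟩

/-! ### The pointwise inequality -/

/-- **Abel summation of the explicit formula, twisted by `n^{-it}`.** Let `K ≥ 0` be a constant
for which the truncated explicit formula (MV Theorem 12.10) holds on `x ≥ 2`. Then for every
`q > 1`, every primitive `χ` mod `q`, every real `t`, `c ∈ [9/4, 11/4]`, `X ≥ 3` and `T ≥ 2`,
`‖∑_{2 < n ≤ X} χ(n)Λ(n) n^{-it} + ∑_{ρ, |γ| ≤ T} m(ρ)(X^{ρ-it} − c^{ρ-it})/(ρ − it)‖ ≤
(2K + 3) log X + 2K (X/T) log²(qXT) + |t| K (4X log X/(cT)^{1/2} + X log²(qXT)/T)`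
(the sum over zeros is over `lfunctionZeroBox χ T` with the multiplicities
`Literature.NumberTheory.LFunctions.DirichletDisc.zeroOrder`, as in `charZeroSumTrunc`).
[cite: MontgomeryVaughan2007, Theorem 12.10 and proof of Theorem 13.7] -/
theorem norm_twistedSum_add_zeroSums_le {K : ℝ} (hK0 : 0 ≤ K)
    (hEF : ∀ (q : ℕ) [NeZero q], 1 < q → ∀ χ : DirichletCharacter ℂ q, χ.IsPrimitive →
      ∀ x : ℝ, 2 ≤ x → ∀ T : ℝ, 2 ≤ T →
        ‖chebyshevPsiChar₀ χ x - (-charZeroSumTrunc χ x T - 1 / 2 * Real.log (x - 1) -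
            χ (-1) / 2 * Real.log (x + 1) + explicitFormulaConst χ)‖ ≤
          K * (Real.log x * min 1 (x / (T * primePowDist x)) + x / T * Real.log (q * x * T) ^ 2))
    {q : ℕ} [NeZero q] {χ : DirichletCharacter ℂ q} (hprim : χ.IsPrimitive) (hq : 1 < q)
    (t : ℝ) {c X T : ℝ} (hc : 9 / 4 ≤ c) (hc' : c ≤ 11 / 4) (hX : 3 ≤ X) (hT : 2 ≤ T) :
    ‖∑ n ∈ Finset.Ioc 2 ⌊X⌋₊, χ n * Λ n * (n : ℂ) ^ (-(t * I)) +
        ∑ ρ ∈ (lfunctionZeroBox_finite (ne_one_of_isPrimitive hprim hq) T).toFinset,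
          (DirichletDisc.zeroOrder χ ρ : ℂ) *
            (((X : ℂ) ^ (ρ - t * I) - (c : ℂ) ^ (ρ - t * I)) / (ρ - t * I))‖ ≤
      (2 * K + 3) * Real.log X + 2 * K * (X / T) * Real.log (q * X * T) ^ 2 +
        |t| * K * (4 * X * Real.log X / Real.sqrt (c * T) + X * Real.log (q * X * T) ^ 2 / T) := by
  classical
  have hχ : χ ≠ 1 := ne_one_of_isPrimitive hprim hq
  set P := (lfunctionZeroBox_finite hχ T).toFinset with hPdef
  have hP : ∀ ρ ∈ P, χ.LFunction ρ = 0 ∧ 0 < ρ.re ∧ ρ.re < 1 ∧ |ρ.im| ≤ T := fun ρ hρ ↦ by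
    simpa [hPdef, mem_lfunctionZeroBox] using hρ
  have hPre : ∀ ρ ∈ P, 0 < ρ.re := fun ρ hρ ↦ (hP ρ hρ).2.1
  have hP0 : ∀ ρ ∈ P, ρ ≠ 0 := fun ρ hρ h ↦ by simpa [h] using hPre ρ hρ
  -- sizes
  have hc0 : 0 < c := by linarith
  have hc2 : 2 ≤ c := by linarith
  have hcX : c ≤ X := by linarith
  obtain ⟨hX0, hX1⟩ : 0 < X ∧ 1 ≤ X := ⟨by linarith, by linarith⟩
  obtain ⟨hT0, hT1⟩ : 0 < T ∧ 1 ≤ T := ⟨by linarith, by linarith⟩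
  have hq1 : (1 : ℝ) ≤ q := by exact_mod_cast hq.le
  have hfloor_c : ⌊c⌋₊ = 2 := (Nat.floor_eq_iff hc0.le).2 ⟨by push_cast; linarith, by push_cast; linarith⟩
  have hlogX : 0 ≤ Real.log X := Real.log_nonneg hX1
  -- the players
  set m : ℂ → ℂ := fun ρ ↦ (DirichletDisc.zeroOrder χ ρ : ℂ) with hm
  set e : ℂ := χ (-1) with he
  have he1 : ‖e‖ ≤ 1 := χ.norm_le_one _
  set E : ℝ → ℂ := fun y ↦ -(∑ ρ ∈ P, m ρ * ((y : ℂ) ^ ρ / ρ)) - 1 / 2 * (Real.log (y - 1) : ℂ) -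
      e / 2 * (Real.log (y + 1) : ℂ) + explicitFormulaConst χ with hE
  set E' : ℝ → ℂ := fun u ↦ -(∑ ρ ∈ P, m ρ * (u : ℂ) ^ (ρ - 1)) - 1 / 2 * (((u - 1)⁻¹ : ℝ) : ℂ) -
      e / 2 * (((u + 1)⁻¹ : ℝ) : ℂ) with hE'
  set f : ℝ → ℂ := fun y ↦ (y : ℂ) ^ (-(t * I)) with hf
  set f' : ℝ → ℂ := fun u ↦ (-(t * I)) * (u : ℂ) ^ (-(t * I) - 1) with hf'
  set cf : ℕ → ℂ := fun n ↦ χ n * Λ n with hcf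
  set ψ : ℝ → ℂ := fun u ↦ chebyshevPsiChar χ u with hψ
  have hsumψ : ∀ u : ℝ, ∑ k ∈ Finset.Icc 0 ⌊u⌋₊, cf k = ψ u := fun u ↦ by
    simp only [hψ, hcf, chebyshevPsiChar, Nat.range_succ_eq_Icc_zero]
  -- `E` is the main term of the explicit formula
  have hEF' : ∀ y, 2 ≤ y → ‖chebyshevPsiChar₀ χ y - E y‖ ≤
      K * (Real.log y * min 1 (y / (T * primePowDist y)) + y / T * Real.log (q * y * T) ^ 2) := by
    intro y hy
    have h := hEF q hq χ hprim y hy T hT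
    rwa [charZeroSumTrunc_eq hχ y T] at h
  -- derivatives
  have hfd : ∀ u ∈ uIcc c X, HasDerivAt f (f' u) u := fun u hu ↦ by
    rw [uIcc_of_le hcX] at hu; exact hasDerivAt_cpow_twist t (hc0.trans_le hu.1)
  have hEd : ∀ u ∈ uIcc c X, HasDerivAt E (E' u) u := fun u hu ↦ by
    rw [uIcc_of_le hcX] at hu
    exact hasDerivAt_mainTerm P m hP0 e _ (by linarith [hu.1])
  -- continuity and integrability
  have hf'c : ContinuousOn f' (Icc c X) := continuousOn_const.mul (continuousOn_ofReal_cpow _ hc0)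
  have hfc : ContinuousOn f (Icc c X) := continuousOn_ofReal_cpow _ hc0
  have hZ'c : ContinuousOn (fun u : ℝ ↦ ∑ ρ ∈ P, m ρ * (u : ℂ) ^ (ρ - 1)) (Icc c X) :=
    continuousOn_finsetSum P fun ρ _ ↦ continuousOn_const.mul (continuousOn_ofReal_cpow _ hc0)
  have hinv1 : ContinuousOn (fun u : ℝ ↦ (((u - 1)⁻¹ : ℝ) : ℂ)) (Icc c X) :=
    continuous_ofReal.comp_continuousOn
      ((continuousOn_id.sub continuousOn_const).inv₀ fun u hu ↦ by
        have : c ≤ u := hu.1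
        simp only [Pi.sub_apply, id_eq, ne_eq]
        intro h; linarith)
  have hinv2 : ContinuousOn (fun u : ℝ ↦ (((u + 1)⁻¹ : ℝ) : ℂ)) (Icc c X) :=
    continuous_ofReal.comp_continuousOn
      ((continuousOn_id.add continuousOn_const).inv₀ fun u hu ↦ by
        have : c ≤ u := hu.1
        simp only [Pi.add_apply, id_eq, ne_eq]
        intro h; linarith)
  have hℓ'c : ContinuousOn (fun u : ℝ ↦ -(1 / 2 * (((u - 1)⁻¹ : ℝ) : ℂ)) -
      e / 2 * (((u + 1)⁻¹ : ℝ) : ℂ)) (Icc c X) :=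
    (continuousOn_const.mul hinv1).neg.sub (continuousOn_const.mul hinv2)
  have hE'c : ContinuousOn E' (Icc c X) :=
    (hZ'c.neg.sub (continuousOn_const.mul hinv1 (f := fun _ ↦ (1 / 2 : ℂ)))).sub
      (continuousOn_const.mul hinv2 (f := fun _ ↦ e / 2))
  have hEc : ContinuousOn E (Icc c X) := fun u hu ↦
    (hEd u (by rwa [uIcc_of_le hcX])).continuousAt.continuousWithinAt
  have hf'i : IntervalIntegrable f' volume c X := hf'c.intervalIntegrable_of_Icc hcX
  have hE'i : IntervalIntegrable E' volume c X := hE'c.intervalIntegrable_of_Icc hcX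
  -- Abel summation
  have hdiff : ∀ u ∈ Icc c X, DifferentiableAt ℝ f u := fun u hu ↦ (hfd u (by rwa [uIcc_of_le hcX])).differentiableAt
  have hderiv : EqOn (deriv f) f' (Icc c X) := fun u hu ↦ (hfd u (by rwa [uIcc_of_le hcX])).deriv
  have hint : IntegrableOn (deriv f) (Icc c X) := hf'c.integrableOn_Icc.congr_fun hderiv.symm measurableSet_Icc
  have hAbel := sum_mul_eq_sub_sub_integral_mul cf hc0.le hcX hdiff hint
  rw [hsumψ X, hsumψ c, hfloor_c] at hAbel
  have hS₃ : ∑ k ∈ Finset.Ioc 2 ⌊X⌋₊, f k * cf k = ∑ n ∈ Finset.Ioc 2 ⌊X⌋₊, χ n * Λ n * (n : ℂ) ^ (-(t * I)) :=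
    Finset.sum_congr rfl fun k _ ↦ by simp only [hf, hcf, ofReal_natCast]; ring
  -- the integral of Abel's formula as an interval integral of `f' ψ`
  have hI : ∫ u in Ioc c X, deriv f u * ∑ k ∈ Finset.Icc 0 ⌊u⌋₊, cf k = ∫ u in c..X, f' u * ψ u := by
    rw [intervalIntegral.integral_of_le hcX]
    refine setIntegral_congr_fun measurableSet_Ioc fun u hu ↦ ?_
    rw [hderiv (Ioc_subset_Icc_self hu), hsumψ u]
  rw [hI, hS₃] at hAbel
  -- integrability of `f' ψ`, `f' E`
  have hψi : IntervalIntegrable (fun u ↦ f' u * ψ u) volume c X := by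
    have h := integrableOn_mul_sum_Icc cf (m := 0) (b := X) hc0.le hf'c.integrableOn_Icc
    simp_rw [hsumψ] at h
    exact (intervalIntegrable_iff_integrableOn_Icc_of_le hcX).2 h
  have hEi : IntervalIntegrable (fun u ↦ f' u * E u) volume c X := (hf'c.mul hEc).intervalIntegrable_of_Icc hcX
  -- split `∫ f' ψ = ∫ f' E + ∫ f' (ψ − E)`
  have hsplit : ∫ u in c..X, f' u * ψ u =
      (∫ u in c..X, f' u * E u) + ∫ u in c..X, f' u * (ψ u - E u) := by
    rw [← intervalIntegral.integral_add hEi]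
    · exact intervalIntegral.integral_congr fun u _ ↦ by ring
    · have : (fun u ↦ f' u * (ψ u - E u)) = fun u ↦ f' u * ψ u - f' u * E u := by funext u; ring
      rw [this]
      exact hψi.sub hEi
  -- integration by parts for the smooth part
  have hIBP : ∫ u in c..X, f' u * E u = E X * f X - E c * f c - ∫ u in c..X, E' u * f u := by
    rw [← intervalIntegral.integral_mul_deriv_eq_deriv_mul hEd hfd hE'i hf'i]
    exact intervalIntegral.integral_congr fun u _ ↦ by ring
  -- `∫ E' f = −(zero sums) + (log part)`
  have hE'f : ∫ u in c..X, E' u * f u =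
      -(∑ ρ ∈ P, m ρ * (((X : ℂ) ^ (ρ - t * I) - (c : ℂ) ^ (ρ - t * I)) / (ρ - t * I))) +
        ∫ u in c..X, (-(1 / 2 * (((u - 1)⁻¹ : ℝ) : ℂ)) - e / 2 * (((u + 1)⁻¹ : ℝ) : ℂ)) * f u := by
    have h1 : ∀ u, E' u * f u = -((∑ ρ ∈ P, m ρ * (u : ℂ) ^ (ρ - 1)) * f u) +
        (-(1 / 2 * (((u - 1)⁻¹ : ℝ) : ℂ)) - e / 2 * (((u + 1)⁻¹ : ℝ) : ℂ)) * f u := by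
      intro u; simp only [hE']; ring
    simp_rw [h1]
    have hi1 : IntervalIntegrable (fun u ↦ -((∑ ρ ∈ P, m ρ * (u : ℂ) ^ (ρ - 1)) * f u)) volume c X :=
      ((hZ'c.mul hfc).intervalIntegrable_of_Icc hcX).neg
    have hi2 : IntervalIntegrable (fun u ↦ (-(1 / 2 * (((u - 1)⁻¹ : ℝ) : ℂ)) -
        e / 2 * (((u + 1)⁻¹ : ℝ) : ℂ)) * f u) volume c X :=
      (hℓ'c.mul hfc).intervalIntegrable_of_Icc hcX
    rw [intervalIntegral.integral_add hi1 hi2, intervalIntegral.integral_neg,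
      integral_zeroDeriv_mul_twist P m hPre t hc0 hcX]
  -- the identity `S₃ + zero sums = f X (ψ X − E X) − f c (ψ c − E c) + (log part) − (remainder)`
  set Zs : ℂ := ∑ ρ ∈ P, m ρ * (((X : ℂ) ^ (ρ - t * I) - (c : ℂ) ^ (ρ - t * I)) / (ρ - t * I))
  set Iℓ : ℂ := ∫ u in c..X, (-(1 / 2 * (((u - 1)⁻¹ : ℝ) : ℂ)) - e / 2 * (((u + 1)⁻¹ : ℝ) : ℂ)) * f u
  set IR : ℂ := ∫ u in c..X, f' u * (ψ u - E u)
  have hid : ∑ n ∈ Finset.Ioc 2 ⌊X⌋₊, χ n * Λ n * (n : ℂ) ^ (-(t * I)) + Zs =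
      f X * (ψ X - E X) - f c * (ψ c - E c) + Iℓ - IR := by linear_combination hAbel - hsplit - hIBP + hE'f
  rw [hid]
  -- the four bounds
  have hfX : ‖f X‖ = 1 := norm_cpow_twist hX0 t
  have hfcn : ‖f c‖ = 1 := norm_cpow_twist hc0 t
  have hq0 : (0 : ℝ) ≤ q := by linarith
  have hqX1 : (1 : ℝ) ≤ q * X := one_le_mul_of_one_le_of_one_le hq1 hX1
  have hL0 : 0 ≤ Real.log (q * X * T) := Real.log_nonneg (one_le_mul_of_one_le_of_one_le hqX1 hT1)
  -- at `X`
  have h1 : ‖f X * (ψ X - E X)‖ ≤ Real.log X / 2 + K * (Real.log X + X / T * Real.log (q * X * T) ^ 2) := by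
    rw [norm_mul, hfX, one_mul]
    have ha := norm_chebyshevPsiChar₀_sub_le χ hX1
    have hb := hEF' X (by linarith)
    have hmin : Real.log X * min 1 (X / (T * primePowDist X)) ≤ Real.log X :=
      mul_le_of_le_one_right hlogX (min_le_left _ _)
    have hb' : ‖chebyshevPsiChar₀ χ X - E X‖ ≤ K * (Real.log X + X / T * Real.log (q * X * T) ^ 2) :=
      hb.trans (mul_le_mul_of_nonneg_left (by linarith) hK0)
    calc ‖ψ X - E X‖ = ‖(chebyshevPsiChar₀ χ X - E X) - (chebyshevPsiChar₀ χ X - chebyshevPsiChar χ X)‖ := by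
          congr 1; simp only [hψ]; ring
      _ ≤ ‖chebyshevPsiChar₀ χ X - E X‖ + ‖chebyshevPsiChar₀ χ X - chebyshevPsiChar χ X‖ :=
          norm_sub_le _ _
      _ ≤ _ := by linarith
  -- at `c`
  have h2 : ‖f c * (ψ c - E c)‖ ≤ Real.log X / 2 + K * (Real.log X + X / T * Real.log (q * X * T) ^ 2) := by
    rw [norm_mul, hfcn, one_mul]
    have hc1 : 1 ≤ c := by linarith
    have ha := norm_chebyshevPsiChar₀_sub_le χ hc1
    have hb := hEF' c hc2
    have hlogc : Real.log c ≤ Real.log X := Real.log_le_log hc0 hcX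
    have hlogc0 : 0 ≤ Real.log c := Real.log_nonneg hc1
    have hmin : Real.log c * min 1 (c / (T * primePowDist c)) ≤ Real.log X :=
      (mul_le_of_le_one_right hlogc0 (min_le_left _ _)).trans hlogc
    have hqc1 : (1 : ℝ) ≤ q * c := one_le_mul_of_one_le_of_one_le hq1 hc1
    have hLc0 : 0 ≤ Real.log (q * c * T) := Real.log_nonneg (one_le_mul_of_one_le_of_one_le hqc1 hT1)
    have hLc : Real.log (q * c * T) ≤ Real.log (q * X * T) :=
      Real.log_le_log (by positivity)
        (mul_le_mul_of_nonneg_right (mul_le_mul_of_nonneg_left hcX hq0) hT0.le)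
    have hsq : c / T * Real.log (q * c * T) ^ 2 ≤ X / T * Real.log (q * X * T) ^ 2 :=
      mul_le_mul (div_le_div_of_nonneg_right hcX hT0.le) (pow_le_pow_left₀ hLc0 hLc 2)
        (sq_nonneg _) (by positivity)
    have hb' : ‖chebyshevPsiChar₀ χ c - E c‖ ≤ K * (Real.log X + X / T * Real.log (q * X * T) ^ 2) :=
      hb.trans (mul_le_mul_of_nonneg_left (by linarith) hK0)
    calc ‖ψ c - E c‖ = ‖(chebyshevPsiChar₀ χ c - E c) - (chebyshevPsiChar₀ χ c - chebyshevPsiChar χ c)‖ := by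
          congr 1; simp only [hψ]; ring
      _ ≤ ‖chebyshevPsiChar₀ χ c - E c‖ + ‖chebyshevPsiChar₀ χ c - chebyshevPsiChar χ c‖ :=
          norm_sub_le _ _
      _ ≤ _ := by linarith
  -- the logarithmic part
  have h3 : ‖Iℓ‖ ≤ 3 / 2 * Real.log X := norm_integral_logDeriv_mul_twist_le he1 t hc2 hcX
  -- the remainder
  have h4 : ‖IR‖ ≤ |t| * K * (4 * X * Real.log X / Real.sqrt (c * T) + X * Real.log (q * X * T) ^ 2 / T) := by
    refine norm_integral_remainder_le hc2 hcX hT1 hK0 hq1 ?_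
    filter_upwards [ae_natFloor_ne] with u hu hmem
    have hu2 : 2 ≤ u := hc2.trans hmem.1.le
    have hu0 : 0 < u := by linarith
    rw [norm_mul, hf', norm_deriv_twist hu0 t, hψ]
    dsimp only
    rw [← chebyshevPsiChar₀_of_floor_ne χ hu]
    exact mul_le_mul_of_nonneg_left (hEF' u hu2) (mul_nonneg (abs_nonneg t) (inv_nonneg.2 hu0.le))
  -- conclusion
  calc ‖f X * (ψ X - E X) - f c * (ψ c - E c) + Iℓ - IR‖
      ≤ ‖f X * (ψ X - E X)‖ + ‖f c * (ψ c - E c)‖ + ‖Iℓ‖ + ‖IR‖ := by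
        have e1 := norm_sub_le (f X * (ψ X - E X) - f c * (ψ c - E c) + Iℓ) IR
        have e2 := norm_add_le (f X * (ψ X - E X) - f c * (ψ c - E c)) Iℓ
        have e3 := norm_sub_le (f X * (ψ X - E X)) (f c * (ψ c - E c))
        linarith
    _ ≤ (Real.log X / 2 + K * (Real.log X + X / T * Real.log (q * X * T) ^ 2)) +
        (Real.log X / 2 + K * (Real.log X + X / T * Real.log (q * X * T) ^ 2)) +
        3 / 2 * Real.log X +
        |t| * K * (4 * X * Real.log X / Real.sqrt (c * T) + X * Real.log (q * X * T) ^ 2 / T) :=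
        add_le_add (add_le_add (add_le_add h1 h2) h3) h4
    _ ≤ _ := by
        have : 0 ≤ K * Real.log X := mul_nonneg hK0 hlogX
        nlinarith [hlogX]

end GRHTwistedPrimeSum

end Literature.NumberTheory.LFunctions
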